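import Literature.AlgebraicGeometry.HodgeTheory.PermutationSymmetry
import Literature.AlgebraicGeometry.HodgeTheory.AlgebraicClasses
import HarnessLib

/-!
# The tower of fully symmetric cubics `p₃ + g·p₁³`

Statement-level (T0) carriers for the pencils of fully `𝔖_{n+2}`-symmetric cubic `n`-folds

  `X⁽ⁿ⁾_g = {x₀³ + ⋯ + x_{n+1}³ + g·(x₀ + ⋯ + x_{n+1})³ = 0} ⊂ ℙⁿ⁺¹_ℂ`,  `g ∈ ℂ`,

`g = 0` the Fermat cubic, `g = -1` the Clebsch–Segre member `{e₁ = e₃ = 0} ⊂ ℙⁿ⁺²` (for `n = 2` the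
Clebsch diagonal surface, for `n = 3` the Segre cubic), used by the summit route
`Summits/HodgeConjecture/HodgeConjecture/Theses/SymmetricCubicTower`.

## Main definitions

* `symmetricCubicForm n g` — the form `p₃ + g·p₁³ = fermatPolynomial ℂ n 3 + C g * (fermatPolynomial ℂ n 1) ^ 3`
  in the `n + 2` variables `x₀, …, x_{n+1}`.
* `symmetricCubic n g` — the hypersurface `X⁽ⁿ⁾_g ⊂ ℙⁿ⁺¹_ℂ` it cuts out
  (`Motives.SmoothHypersurface.hypersurface`; no smoothness is asserted — the member is singular exactly
  for `g = -1/(n+2-2k)²`, `0 ≤ k ≤ n/2`, which statements using it carry as a hypothesis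
  `Motives.IsSmoothProjective n (symmetricCubic n g)`).
* `IsSignIsotypic F k c` — the class `c ∈ Hᵏ(X_F(ℂ); ℂ)` on the hypersurface of a form `F` lies in the
  **sign-isotypic component** of the geometric action of the coordinate-permutation stabiliser of `F`:
  `p_π^* c = sgn(π)·c` for every `π ∈ permStabilizer F` (`permMap`, `PermutationSymmetry`). For a fully
  symmetric form (`permStabilizer F = ⊤`) and the middle cohomology of `X_F` this is, via Griffiths
  residues (`γ_π^* Ω = sgn(π)·Ω`), the multiplicity space of the *invariant* part of the Jacobian ring.

## Main statements

* `symmetricCubicForm_zero` — `g = 0` is the Fermat cubic form.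
* `isHomogeneous_symmetricCubicForm` — homogeneous of degree `3`.
* `rename_symmetricCubicForm`, `permStabilizer_symmetricCubicForm` — every coordinate permutation fixes
  the form: the stabiliser is all of `𝔖_{n+2}`.
* `IsSignIsotypic.zero/add/smul`, `signIsotypicClasses` — the sign-isotypic classes form a `ℂ`-submodule.

## References

* I. Dolgachev, *Classical Algebraic Geometry* (CUP 2012), §9.5.4 (the Clebsch diagonal surface
  `∑ tᵢ = ∑ tᵢ³ = 0`).
* B. Hunt, *The Geometry of some special Arithmetic Quotients*, LNM 1637 (1996), Ch. 3 (the Segre cubic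
  `∑ xᵢ = ∑ xᵢ³ = 0`).
* T. Shioda, *The Hodge conjecture for Fermat varieties*, Math. Ann. 245 (1979), §1 (coordinate
  symmetries of Fermat-type hypersurfaces).
* P. Griffiths, *On the periods of certain rational integrals* I, II, Ann. of Math. 90 (1969) (residues and
  the Jacobian ring; the action of a linear automorphism on `AΩ/Fᵏ`).
-/

noncomputable section

open CategoryTheory AlgebraicGeometry MvPolynomial

namespace Literature.AlgebraicGeometry.HodgeTheory

open Literature.AlgebraicGeometry.Motives Literature.AlgebraicTopology.SingularHomology

variable {n : ℕ}

/-! ### The form `p₃ + g·p₁³` and the hypersurface it cuts out -/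

/-- **The fully symmetric cubic form** `p₃ + g·p₁³ = ∑ᵢ xᵢ³ + g·(∑ᵢ xᵢ)³` in the `n + 2` variables
`x₀, …, x_{n+1}`, `g ∈ ℂ` the pencil parameter (`g = 0`: the Fermat cubic; `g = -1`: the Clebsch–Segre
member). [cite: Dolgachev2012, §9.5.4] [cite: Hunt1996, Ch. 3] -/
def symmetricCubicForm (n : ℕ) (g : ℂ) : MvPolynomial (Fin (n + 2)) ℂ :=
  fermatPolynomial ℂ n 3 + C g * fermatPolynomial ℂ n 1 ^ 3

/-- **The fully symmetric cubic `n`-fold** `X⁽ⁿ⁾_g = {p₃ + g·p₁³ = 0} ⊂ ℙⁿ⁺¹_ℂ`, as the hypersurface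
scheme of the form (no smoothness asserted). [cite: Dolgachev2012, §9.5.4] [cite: Hunt1996, Ch. 3] -/
abbrev symmetricCubic (n : ℕ) (g : ℂ) : SchemeOver ℂ :=
  SmoothHypersurface.hypersurface (symmetricCubicForm n g)

/-- The member `g = 0` of the pencil is the Fermat cubic form `∑ᵢ xᵢ³`. [folklore] -/
theorem symmetricCubicForm_zero (n : ℕ) : symmetricCubicForm n 0 = fermatPolynomial ℂ n 3 := by
  simp [symmetricCubicForm]

/-- The fully symmetric cubic form is homogeneous of degree `3`. [folklore] -/
theorem isHomogeneous_symmetricCubicForm (n : ℕ) (g : ℂ) :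
    (symmetricCubicForm n g).IsHomogeneous 3 := by
  refine (isHomogeneous_fermatPolynomial n 3).add ?_
  have h : (C g * fermatPolynomial ℂ n 1 ^ 3).IsHomogeneous (0 + 1 * 3) :=
    (isHomogeneous_C _ g).mul ((isHomogeneous_fermatPolynomial n 1).pow 3)
  simpa using h

/-- Every permutation of the coordinates fixes the Fermat form (the `rename` form of
`permStabilizer_fermatPolynomial`). [cite: Shioda1979HodgeFermat, §1] -/
theorem rename_fermatPolynomial (π : Equiv.Perm (Fin (n + 2))) (m : ℕ) :
    rename π (fermatPolynomial ℂ n m) = fermatPolynomial ℂ n m :=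
  mem_permStabilizer_iff_rename.mp (mem_permStabilizer_fermatPolynomial m π)

/-- **Every permutation of the coordinates fixes `p₃ + g·p₁³`.** [cite: Shioda1979HodgeFermat, §1] -/
theorem rename_symmetricCubicForm (π : Equiv.Perm (Fin (n + 2))) (g : ℂ) :
    rename π (symmetricCubicForm n g) = symmetricCubicForm n g := by
  simp only [symmetricCubicForm, map_add, map_mul, map_pow, rename_C, rename_fermatPolynomial]

/-- **The permutation stabiliser of `p₃ + g·p₁³` is all of `𝔖_{n+2}`**: the pencil consists of fully
symmetric cubics. [cite: Shioda1979HodgeFermat, §1] -/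
theorem permStabilizer_symmetricCubicForm (g : ℂ) : permStabilizer (symmetricCubicForm n g) = ⊤ :=
  eq_top_iff.mpr fun π _ ↦ mem_permStabilizer_iff_rename.mpr (rename_symmetricCubicForm π g)

/-- Every permutation lies in the stabiliser of `p₃ + g·p₁³`. [cite: Shioda1979HodgeFermat, §1] -/
theorem mem_permStabilizer_symmetricCubicForm (g : ℂ) (π : Equiv.Perm (Fin (n + 2))) :
    π ∈ permStabilizer (symmetricCubicForm n g) := by
  rw [permStabilizer_symmetricCubicForm]; exact Subgroup.mem_top π

/-! ### The sign-isotypic component of the geometric permutation action -/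

/-- **Sign-isotypic classes.** A class `c ∈ Hᵏ(X_F(ℂ); ℂ)` on the hypersurface `X_F` of a form `F` is
*sign-isotypic* for the geometric action of the coordinate permutations preserving `F` if
`p_π^* c = sgn(π)·c` for every `π ∈ permStabilizer F` (`p_π = permMap F hπ`, pull-back
`singularCohomology.map`). For the middle cohomology of a fully symmetric smooth hypersurface this is the
isotypic component of the sign character, whose Hodge pieces are, by Griffiths' residue calculus
(`γ^*(AΩ/Fˡ) = (A∘γ)·det γ·Ω/Fˡ`, `det π = sgn π`), the **invariants** of the Jacobian ring in the residue
degrees. [cite: Griffiths1969, §4 and §8] [cite: Shioda1979HodgeFermat, §1] -/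
def IsSignIsotypic (F : MvPolynomial (Fin (n + 2)) ℂ) (k : ℕ)
    (c : complexBetti (SmoothHypersurface.hypersurface F) k) : Prop :=
  ∀ (π : Equiv.Perm (Fin (n + 2))) (hπ : π ∈ permStabilizer F),
    singularCohomology.map ℂ ℂ (permMap F hπ) k c = ((Equiv.Perm.sign π : ℤ) : ℂ) • c

namespace IsSignIsotypic

variable {F : MvPolynomial (Fin (n + 2)) ℂ} {k : ℕ}

/-- The zero class is sign-isotypic. [folklore] -/
theorem zero : IsSignIsotypic F k 0 := fun π hπ ↦ by simp

/-- Sums of sign-isotypic classes are sign-isotypic. [folklore] -/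
theorem add {c d : complexBetti (SmoothHypersurface.hypersurface F) k} (hc : IsSignIsotypic F k c)
    (hd : IsSignIsotypic F k d) : IsSignIsotypic F k (c + d) := fun π hπ ↦ by
  rw [map_add, hc π hπ, hd π hπ, smul_add]

/-- Scalar multiples of sign-isotypic classes are sign-isotypic. [folklore] -/
theorem smul (a : ℂ) {c : complexBetti (SmoothHypersurface.hypersurface F) k} (hc : IsSignIsotypic F k c) :
    IsSignIsotypic F k (a • c) := fun π hπ ↦ by
  rw [map_smul, hc π hπ, smul_comm]

end IsSignIsotypic

/-- **The sign-isotypic component** `Hᵏ(X_F(ℂ); ℂ)^{sgn}` as a `ℂ`-submodule. [cite: Griffiths1969, §4 and §8] -/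
def signIsotypicClasses (F : MvPolynomial (Fin (n + 2)) ℂ) (k : ℕ) :
    Submodule ℂ (complexBetti (SmoothHypersurface.hypersurface F) k) where
  carrier := {c | IsSignIsotypic F k c}
  add_mem' := IsSignIsotypic.add
  zero_mem' := IsSignIsotypic.zero
  smul_mem' := IsSignIsotypic.smul

/-- Membership in the sign-isotypic component is the predicate `IsSignIsotypic`. [folklore] -/
theorem mem_signIsotypicClasses_iff {F : MvPolynomial (Fin (n + 2)) ℂ} {k : ℕ}
    {c : complexBetti (SmoothHypersurface.hypersurface F) k} :
    c ∈ signIsotypicClasses F k ↔ IsSignIsotypic F k c := Iff.rfl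

/-- For a fully symmetric form (`permStabilizer F = ⊤`, e.g. `p₃ + g·p₁³`) sign-isotypy is the condition
over **all** permutations. [folklore] -/
theorem isSignIsotypic_iff_of_permStabilizer_eq_top {F : MvPolynomial (Fin (n + 2)) ℂ}
    (hF : permStabilizer F = ⊤) {k : ℕ} (c : complexBetti (SmoothHypersurface.hypersurface F) k) :
    IsSignIsotypic F k c ↔ ∀ π : Equiv.Perm (Fin (n + 2)),
      singularCohomology.map ℂ ℂ (permMap F (hF ▸ Subgroup.mem_top π)) k c =
        ((Equiv.Perm.sign π : ℤ) : ℂ) • c :=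
  ⟨fun h π ↦ h π _, fun h π _ ↦ h π⟩

end Literature.AlgebraicGeometry.HodgeTheory

end
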